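import Mathlib
import Summits.QuantumFields.YangMills.Theorems.ConvexGribovBodyContinuumLegGivenGapStubRpCoreA
import HarnessLib

/-!
# `ContinuumFromLatticeGap` (stmt-QuantumFields-15915), line `registered` (reshape 6): `stub_rpSeminorm`

Support file for the crux item stmt-QuantumFields-15915
(`Summit.QuantumFields.YangMills.Theses.GronwallGap.ContinuumFromLatticeGap`), registered stub
`stub_rpSeminorm` of the line `registered` (reshape 6): **Minkowski's inequality for the reflected diagonal
form on the odd torus**.

**Statement.** For finitely many real bounded measurable cylinder observables `F i` (`i ∈ s`) of the `ℤ⁴` gauge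
field supported on links based at times `0 ≤ x₀ ≤ w`, on the odd torus of side `2S+1` with `S ≥ 2w + 8` at
`β ≥ 0`, and real coefficients `c i`: for every `m ≤ S`,
`√corr((Σ cᵢFᵢ)∘Θ, Σ cᵢFᵢ; m) ≤ Σ |cᵢ| √corr(Fᵢ∘Θ, Fᵢ; m)`, where `Θ = gaugeTimeReflect` and
`corr = latticeConnectedCorr r.ρ β (2S+1)`.

**Proof.** (1) Bilinear expansion (`RpSeminorm.corr_sum_sum`): the connected correlation is
`∫ A(Ũ) B(τ Ũ) dμ − (∫ A(Ũ) dμ)(∫ B(Ũ) dμ)` under the probability measure `μ = wilsonMeasure r.ρ β`, and all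
integrands are bounded measurable, so linearity of the integral gives
`corr((Σᵢ cᵢFᵢ)∘Θ, Σⱼ cⱼFⱼ; m) = Σᵢ Σⱼ cᵢ cⱼ corr(Fᵢ∘Θ, Fⱼ; m)`. (2) Each cross term is bounded by the landed
Cauchy–Schwarz inequality of the reflection-positive forms `RpCoreA.corr_sq_le`
(`corr(Fᵢ∘Θ, Fⱼ; m)² ≤ gᵢ gⱼ`, `gᵢ := corr(Fᵢ∘Θ, Fᵢ; m) ≥ 0` by `RpCoreA.corr_nonneg`), whence
`corr(Y∘Θ, Y; m) ≤ Σᵢ Σⱼ |cᵢ| |cⱼ| √gᵢ √gⱼ = (Σᵢ |cᵢ| √gᵢ)²` (`RpSeminorm.corr_sum_le_sq`). (3) Take square roots.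

No definitions, no facts; Mathlib + the landed `RpCoreA` estimates only. References: K. Osterwalder, E. Seiler,
Ann. Phys. 110 (1978) 440, §2 (folklore manipulations). [folklore]
-/

noncomputable section

namespace Summit.QuantumFields.YangMills.Theorems.ContinuumFromLatticeGap

open Filter Topology MeasureTheory
open Literature.MathematicalPhysics.QuantumFieldTheory Literature.MathematicalPhysics.QuantumLattice
  Literature.MathematicalPhysics.AQFT Literature.Probability.LatticeModels
open Summit.QuantumFields.YangMills.Theorems.ContinuumLegGivenGap

namespace RpSeminorm

variable {G : Type} [Group G] [TopologicalSpace G] [IsTopologicalGroup G] [CompactSpace G]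
  [MeasurableSpace G] [BorelSpace G]

/-- **Bilinear expansion of the reflected connected correlation of a finite linear combination**: for bounded
measurable `F i` (`i ∈ s`) and real `c i`, on a torus of side `L ≥ 1`,
`corr((Σᵢ cᵢFᵢ)∘Θ, Σⱼ cⱼFⱼ; m) = Σᵢ Σⱼ cᵢ cⱼ corr(Fᵢ∘Θ, Fⱼ; m)` (linearity of the integral on bounded
measurable integrands for the probability measure `wilsonMeasure`). [folklore] -/
theorem corr_sum_sum (r : LatticeRep G) (β : ℝ) (L : ℕ) [NeZero L] {ι : Type} (s : Finset ι)
    (F : ι → LGConfig 4 G → ℝ) (c : ι → ℝ) (hFm : ∀ i ∈ s, Measurable (F i))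
    (hFb : ∀ i ∈ s, ∃ C : ℝ, ∀ U, |F i U| ≤ C) (m : ℕ) :
    latticeConnectedCorr r.ρ β L ((fun U => ∑ i ∈ s, c i * F i U) ∘ gaugeTimeReflect)
        (fun U => ∑ i ∈ s, c i * F i U) m =
      ∑ i ∈ s, ∑ j ∈ s, c i * c j * latticeConnectedCorr r.ρ β L (F i ∘ gaugeTimeReflect) (F j) m := by
  haveI := isProbabilityMeasure_wilsonMeasure (d := 4) (L := L) r.ρ r.continuous β
  have hlift : Measurable (torusLift (d := 4) (G := G) L) := measurable_torusLift L
  have hΘl : Measurable fun U : GaugeConfig 4 L G => (gaugeTimeReflect (torusLift L U) : LGConfig 4 G) :=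
    (Summit.QuantumFields.YangMills.Theorems.ClusteringToYangMills.Reconstructible.measurable_gaugeTimeReflect).comp
      hlift
  have hsh : Measurable fun U : GaugeConfig 4 L G =>
      (configShift (-Pi.single 0 (m : ℤ)) (torusLift L U) : LGConfig 4 G) :=
    (Literature.MathematicalPhysics.QuantumLattice.configShift _).measurable.comp hlift
  -- integrability of the reflected, plain and paired observables
  have ia : ∀ i ∈ s, Integrable (fun U : GaugeConfig 4 L G => F i (gaugeTimeReflect (torusLift L U)))
      (wilsonMeasure r.ρ β) := fun i hi => by
    obtain ⟨C, hC⟩ := hFb i hi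
    exact rpShift_integrable_comp (hFm i hi) hC hΘl
  have ib : ∀ j ∈ s, Integrable (fun U : GaugeConfig 4 L G => F j (torusLift L U)) (wilsonMeasure r.ρ β) :=
    fun j hj => by
    obtain ⟨C, hC⟩ := hFb j hj
    exact rpShift_integrable_comp (hFm j hj) hC hlift
  have iab : ∀ i ∈ s, ∀ j ∈ s, Integrable (fun U : GaugeConfig 4 L G =>
      F i (gaugeTimeReflect (torusLift L U)) * F j (configShift (-Pi.single 0 (m : ℤ)) (torusLift L U)))
      (wilsonMeasure r.ρ β) := fun i hi j hj => by
    obtain ⟨Ci, hCi⟩ := hFb i hi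
    obtain ⟨Cj, hCj⟩ := hFb j hj
    exact rpShift_integrable_mul ((hFm i hi).comp hΘl) ((hFm j hj).comp hsh) (fun U => hCi _) (fun U => hCj _)
  -- the three integrals
  have key : ∀ U : GaugeConfig 4 L G,
      (∑ i ∈ s, c i * F i (gaugeTimeReflect (torusLift L U))) *
          (∑ j ∈ s, c j * F j (configShift (-Pi.single 0 (m : ℤ)) (torusLift L U))) =
        ∑ i ∈ s, ∑ j ∈ s, c i * c j *
          (F i (gaugeTimeReflect (torusLift L U)) * F j (configShift (-Pi.single 0 (m : ℤ)) (torusLift L U))) := by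
    intro U
    rw [Finset.sum_mul_sum]
    exact Finset.sum_congr rfl fun i _ => Finset.sum_congr rfl fun j _ => by ring
  have h1 : ∫ U : GaugeConfig 4 L G, (∑ i ∈ s, c i * F i (gaugeTimeReflect (torusLift L U))) *
        (∑ j ∈ s, c j * F j (configShift (-Pi.single 0 (m : ℤ)) (torusLift L U))) ∂(wilsonMeasure r.ρ β) =
      ∑ i ∈ s, ∑ j ∈ s, c i * c j * ∫ U : GaugeConfig 4 L G,
        F i (gaugeTimeReflect (torusLift L U)) * F j (configShift (-Pi.single 0 (m : ℤ)) (torusLift L U))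
          ∂(wilsonMeasure r.ρ β) := by
    simp_rw [key]
    rw [integral_finsetSum _ fun i hi =>
      integrable_finsetSum _ fun j hj => (iab i hi j hj).const_mul (c i * c j)]
    refine Finset.sum_congr rfl fun i hi => ?_
    rw [integral_finsetSum _ fun j hj => (iab i hi j hj).const_mul (c i * c j)]
    exact Finset.sum_congr rfl fun j _ => integral_const_mul _ _
  have h2 : ∫ U : GaugeConfig 4 L G, ∑ i ∈ s, c i * F i (gaugeTimeReflect (torusLift L U))
        ∂(wilsonMeasure r.ρ β) =
      ∑ i ∈ s, c i * ∫ U : GaugeConfig 4 L G, F i (gaugeTimeReflect (torusLift L U)) ∂(wilsonMeasure r.ρ β) := by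
    rw [integral_finsetSum _ fun i hi => (ia i hi).const_mul (c i)]
    exact Finset.sum_congr rfl fun i _ => integral_const_mul _ _
  have h3 : ∫ U : GaugeConfig 4 L G, ∑ j ∈ s, c j * F j (torusLift L U) ∂(wilsonMeasure r.ρ β) =
      ∑ j ∈ s, c j * ∫ U : GaugeConfig 4 L G, F j (torusLift L U) ∂(wilsonMeasure r.ρ β) := by
    rw [integral_finsetSum _ fun j hj => (ib j hj).const_mul (c j)]
    exact Finset.sum_congr rfl fun j _ => integral_const_mul _ _
  unfold latticeConnectedCorr
  simp only [Function.comp_apply]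
  rw [h1, h2, h3, Finset.sum_mul_sum, ← Finset.sum_sub_distrib]
  refine Finset.sum_congr rfl fun i _ => ?_
  rw [← Finset.sum_sub_distrib]
  refine Finset.sum_congr rfl fun j _ => ?_
  ring

variable (r : LatticeRep G) {β : ℝ} (hβ : 0 ≤ β) (S w : ℕ) (hS : 2 * w + 8 ≤ S) {ι : Type} (s : Finset ι)
  {F : ι → LGConfig 4 G → ℝ} (c : ι → ℝ) {Λ : ι → Finset (Literature.MathematicalPhysics.QuantumLattice.ZdEdge 4)}
  (hFm : ∀ i ∈ s, Measurable (F i)) (hFb : ∀ i ∈ s, ∃ C : ℝ, ∀ U, |F i U| ≤ C)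
  (hFc : ∀ i ∈ s, IsCylinder (F i) (Λ i)) (htF : ∀ i ∈ s, ∀ e ∈ Λ i, 0 ≤ e.1 0 ∧ e.1 0 ≤ (w : ℤ))

include hβ hS hFm hFb hFc htF in
/-- **The squared Minkowski bound**: for `m ≤ S`,
`corr((Σ cᵢFᵢ)∘Θ, Σ cᵢFᵢ; m) ≤ (Σ |cᵢ| √corr(Fᵢ∘Θ, Fᵢ; m))²` — expand bilinearly (`corr_sum_sum`) and bound
each cross term by `|corr(Fᵢ∘Θ, Fⱼ; m)| ≤ √gᵢ √gⱼ` (`RpCoreA.corr_sq_le`, `RpCoreA.corr_nonneg`). [folklore] -/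
theorem corr_sum_le_sq (m : ℕ) (hm : m ≤ S) :
    latticeConnectedCorr r.ρ β (2 * S + 1) ((fun U => ∑ i ∈ s, c i * F i U) ∘ gaugeTimeReflect)
        (fun U => ∑ i ∈ s, c i * F i U) m ≤
      (∑ i ∈ s, |c i| *
        Real.sqrt (latticeConnectedCorr r.ρ β (2 * S + 1) (F i ∘ gaugeTimeReflect) (F i) m)) ^ 2 := by
  have hg0 : ∀ i ∈ s, 0 ≤ latticeConnectedCorr r.ρ β (2 * S + 1) (F i ∘ gaugeTimeReflect) (F i) m :=
    fun i hi => RpCoreA.corr_nonneg r hβ S w hS (hFm i hi) (hFb i hi) (hFc i hi) (htF i hi) m hm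
  have hcross : ∀ i ∈ s, ∀ j ∈ s,
      |latticeConnectedCorr r.ρ β (2 * S + 1) (F i ∘ gaugeTimeReflect) (F j) m| ≤
        Real.sqrt (latticeConnectedCorr r.ρ β (2 * S + 1) (F i ∘ gaugeTimeReflect) (F i) m) *
          Real.sqrt (latticeConnectedCorr r.ρ β (2 * S + 1) (F j ∘ gaugeTimeReflect) (F j) m) := by
    intro i hi j hj
    rw [← Real.sqrt_mul (hg0 i hi)]
    exact Real.abs_le_sqrt (RpCoreA.corr_sq_le r hβ S w hS (hFm i hi) (hFm j hj) (hFb i hi) (hFb j hj)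
      (hFc i hi) (hFc j hj) (htF i hi) (htF j hj) m hm)
  rw [corr_sum_sum r β (2 * S + 1) s F c hFm hFb m, sq, Finset.sum_mul_sum]
  refine Finset.sum_le_sum fun i hi => Finset.sum_le_sum fun j hj => ?_
  calc c i * c j * latticeConnectedCorr r.ρ β (2 * S + 1) (F i ∘ gaugeTimeReflect) (F j) m
      ≤ |c i * c j * latticeConnectedCorr r.ρ β (2 * S + 1) (F i ∘ gaugeTimeReflect) (F j) m| :=
        le_abs_self _
    _ = |c i| * |c j| * |latticeConnectedCorr r.ρ β (2 * S + 1) (F i ∘ gaugeTimeReflect) (F j) m| := by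
        rw [abs_mul, abs_mul]
    _ ≤ |c i| * |c j| *
          (Real.sqrt (latticeConnectedCorr r.ρ β (2 * S + 1) (F i ∘ gaugeTimeReflect) (F i) m) *
            Real.sqrt (latticeConnectedCorr r.ρ β (2 * S + 1) (F j ∘ gaugeTimeReflect) (F j) m)) :=
        mul_le_mul_of_nonneg_left (hcross i hi j hj) (by positivity)
    _ = |c i| * Real.sqrt (latticeConnectedCorr r.ρ β (2 * S + 1) (F i ∘ gaugeTimeReflect) (F i) m) *
          (|c j| * Real.sqrt (latticeConnectedCorr r.ρ β (2 * S + 1) (F j ∘ gaugeTimeReflect) (F j) m)) := by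
        ring

end RpSeminorm

/-- **Minkowski for the reflected diagonal form on the odd torus** (registered stub `stub_rpSeminorm` of
stmt-QuantumFields-15915, reshape 6).  For finitely many real bounded measurable cylinder observables `F i` of `ℤ⁴`
supported on links based at times `0 ≤ x₀ ≤ w`, on the odd torus `2S+1` with `S ≥ 2w+8` at `β ≥ 0`, and real
coefficients `c i`: for every `m ≤ S`,
`√corr((Σ cᵢFᵢ)∘Θ, Σ cᵢFᵢ; m) ≤ Σ |cᵢ| √corr(Fᵢ∘Θ, Fᵢ; m)` (`Θ = gaugeTimeReflect`, `corr = latticeConnectedCorr`):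
expand bilinearly and bound each cross term by `RpCoreA.corr_sq_le` (Cauchy–Schwarz of the bond/site RP forms,
`RpCoreA.corr_nonneg`), then take square roots. [folklore] -/
theorem stub_rpSeminorm :
    ∀ (G : Type) [Group G] [TopologicalSpace G] [IsTopologicalGroup G] [CompactSpace G]
      [MeasurableSpace G] [BorelSpace G] (r : LatticeRep G) (β : ℝ), 0 ≤ β → ∀ (S w : ℕ), 2 * w + 8 ≤ S →
      ∀ (ι : Type) (s : Finset ι) (F : ι → LGConfig 4 G → ℝ) (c : ι → ℝ)
        (Λ : ι → Finset (Literature.MathematicalPhysics.QuantumLattice.ZdEdge 4)),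
      (∀ i ∈ s, Measurable (F i)) → (∀ i ∈ s, ∃ C : ℝ, ∀ U, |F i U| ≤ C) → (∀ i ∈ s, IsCylinder (F i) (Λ i)) →
      (∀ i ∈ s, ∀ e ∈ Λ i, 0 ≤ e.1 0 ∧ e.1 0 ≤ (w : ℤ)) → ∀ m : ℕ, m ≤ S →
        Real.sqrt (latticeConnectedCorr r.ρ β (2 * S + 1) ((fun U => ∑ i ∈ s, c i * F i U) ∘ gaugeTimeReflect)
            (fun U => ∑ i ∈ s, c i * F i U) m) ≤
          ∑ i ∈ s, |c i| * Real.sqrt (latticeConnectedCorr r.ρ β (2 * S + 1) (F i ∘ gaugeTimeReflect) (F i) m) := by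
  intro G _ _ _ _ _ _ r β hβ S w hS ι s F c Λ hFm hFb hFc htF m hm
  calc Real.sqrt (latticeConnectedCorr r.ρ β (2 * S + 1) ((fun U => ∑ i ∈ s, c i * F i U) ∘ gaugeTimeReflect)
          (fun U => ∑ i ∈ s, c i * F i U) m)
      ≤ Real.sqrt ((∑ i ∈ s, |c i| *
          Real.sqrt (latticeConnectedCorr r.ρ β (2 * S + 1) (F i ∘ gaugeTimeReflect) (F i) m)) ^ 2) :=
        Real.sqrt_le_sqrt (RpSeminorm.corr_sum_le_sq r hβ S w hS s c hFm hFb hFc htF m hm)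
    _ = ∑ i ∈ s, |c i| * Real.sqrt (latticeConnectedCorr r.ρ β (2 * S + 1) (F i ∘ gaugeTimeReflect) (F i) m) :=
        Real.sqrt_sq (Finset.sum_nonneg fun i _ => mul_nonneg (abs_nonneg _) (Real.sqrt_nonneg _))

end Summit.QuantumFields.YangMills.Theorems.ContinuumFromLatticeGap

end
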